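import Summits.NavierStokesRegularity.NavierStokesRegularity.Theorems.TypeIQuarterGateQuarterLawTypeILateLocalTypeI
import Summits.NavierStokesRegularity.NavierStokesRegularity.Theorems.TypeIQuarterGateQuarterLawTypeISparseCoreEngine
import Summits.NavierStokesRegularity.NavierStokesRegularity.Theorems.AdiabaticEddyFrozenEddyAxisymOffAxis
import Literature.Analysis.FluidPDE.PerturbedEnergyInequality
import Literature.Analysis.FluidPDE.CylinderAubinLions
import HarnessLib

/-!
# The sup-norm Type-I rate forces UNIFORM LOCAL TYPE I on the whole life span
# (`UniformLocalTypeI T u` of the 1574 shelf's line `sparse_sieve`, unfolded)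

Helper file (`--supports stmt-NavierStokesRegularity-23726`; also the content of stub S1
`stub_uniformLocalTypeI` of `Cruxes/EnstrophyQuarterLaw/Lines/sparse_sieve.lean` ON THE TYPE-I STRATUM:
S1 follows from `NoTypeII` for each solution). For a classical solution on `[0,T)` (viscosity `ν`),
Leray–Hopf on `[0,T]` from a rapidly decaying datum, with the sup-norm Type-I rate at `T`:
there are `M, r₀ > 0` with
(A) `∫_{B(x,R)} |u(s)|² ≤ M R` for all `s ∈ [0,T)`, `x`, `0 < R ≤ r₀`;
(E) `∫_{b−R²}^{b} ∫_{B(x,R)} ‖∇u‖² ≤ M R` for all `0 < b ≤ T`, `x`, `0 < R ≤ r₀`, `R² ≤ b`.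

PROOF: late times by `CountQuarterLaw.late_scaledBounds_of_isTypeIBlowup` (Seregin 2014 Prop. 3.11 (i)
at every admissible apex, un-zoomed), the `E`-part passed from the product integral to the iterated one
by Tonelli (the integrand is continuous on the open slab:
`PerturbedEnergyInequality.continuousOn_frobeniusNormSq_fderiv_slice`) and `‖·‖_op ≤ |·|_F`; early
times by the sup bound on compact sub-slabs (`bounded_subslab_of_lerayHopf`,
`LocalTypeI.setLIntegral_ball_sq_le_of_bound`) and, for (E), by the whole-space div–curl bound and the
`H¹` bound of the Chae/BKM class on `[0, T']` (`RungReynoldsOne.stub_taoCover`).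

HONEST FRAMING: known mathematics along ONE hypothetical Type-I blow-up; `UniformLocalTypeI` in general
(without Type I), `EnstrophyQuarterLaw` and NS regularity remain OPEN; nothing about the summit is
claimed. [cite: Seregin2014, Ch. 6 §6.3 Prop. 3.11 (i)] [cite: AlbrittonBarker2019, Lemma 2.6]
-/

noncomputable section

-- the summit-side namespace repeats a component by design (D-0017)
set_option linter.dupNamespace false

namespace Summit.NavierStokesRegularity.NavierStokesRegularity.Theorems.CountQuarterLaw

open Set MeasureTheory Function Metric Filter Topology
open scoped ENNReal NNReal
open Literature.Analysis.FluidPDE EnstrophyQuarterLaw.LocalTypeI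

variable {ν T : ℝ} {u : ℝ → EuclideanSpace ℝ (Fin 3) → EuclideanSpace ℝ (Fin 3)}
  {p : ℝ → EuclideanSpace ℝ (Fin 3) → ℝ}

/-- **Type-I rate ⇒ `UniformLocalTypeI T u`** (unfolded verbatim): a classical Leray–Hopf solution on
`[0,T)` from a rapidly decaying datum with `IsTypeIBlowup u T` is uniformly locally Type I in the CKN
`A`- and `E`-currencies. [cite: Seregin2014, Ch. 6 §6.3 Prop. 3.11 (i)] [cite: AlbrittonBarker2019, Lemma 2.6] -/
theorem uniformLocalTypeI_of_isTypeIBlowup (hν : 0 < ν) (hT : 0 < T)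
    (hsol : IsClassicalNSSolutionOn (Ico 0 T) ν 0 u p) (hLH : IsLerayHopfOn T ν 0 (u 0) u)
    (hdec : HasRapidSpatialDecay (u 0)) (hI : IsTypeIBlowup u T) :
    ∃ M r₀ : ℝ, 0 < M ∧ 0 < r₀ ∧
      (∀ s ∈ Set.Ico 0 T, ∀ (x : EuclideanSpace ℝ (Fin 3)), ∀ R ∈ Set.Ioc 0 r₀,
        ∫⁻ y in Metric.ball x R, ‖u s y‖ₑ ^ 2 ≤ ENNReal.ofReal (M * R)) ∧
      (∀ b ∈ Set.Ioc 0 T, ∀ (x : EuclideanSpace ℝ (Fin 3)), ∀ R ∈ Set.Ioc 0 r₀, R ^ 2 ≤ b →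
        ∫⁻ t in Set.Ioo (b - R ^ 2) b, ∫⁻ y in Metric.ball x R, ‖fderiv ℝ (u t) y‖ₑ ^ 2 ≤
          ENNReal.ofReal (M * R)) := by
  obtain ⟨M₁, r₁, tstar, hM₁, hr₁, htT, ht0, hA, hE⟩ :=
    late_scaledBounds_of_isTypeIBlowup hν hT hsol hLH hI
  -- the compact sub-slab `[0, T']`, `T' = (t⋆ + T)/2`
  set T' : ℝ := (tstar + T) / 2 with hT'
  have hT'I : T' ∈ Ioo 0 T := ⟨by rw [hT']; linarith, by rw [hT']; linarith⟩
  have htT' : tstar < T' := by rw [hT']; linarith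
  obtain ⟨V, hV⟩ := bounded_subslab_of_lerayHopf hν hsol hLH hdec T' hT'I
  -- the `H¹` bound on `[0, T']` (Chae/BKM class via the tree's sub-slab cover)
  obtain ⟨q, -, hB, -, -⟩ := RungReynoldsOne.stub_taoCover hν hT hsol hLH hdec hT'I
  obtain ⟨C₁, hC₁⟩ := hB 1
  have hcurl : ∀ t ∈ Icc 0 T', ∫⁻ x, ‖curl (u t) x‖ₑ ^ 2 ≤ 6 * (C₁ : ℝ≥0∞) := fun t ht =>
    calc ∫⁻ x, ‖curl (u t) x‖ₑ ^ 2 ≤ ∫⁻ x, 6 * ‖iteratedFDeriv ℝ 1 (u t) x‖ₑ ^ 2 :=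
          lintegral_mono fun x => RungReynoldsOne.enorm_curl_sq_le_six_mul (u t) x
      _ = 6 * ∫⁻ x, ‖iteratedFDeriv ℝ 1 (u t) x‖ₑ ^ 2 := lintegral_const_mul' _ _ (by norm_num)
      _ ≤ 6 * C₁ := by gcongr; exact hC₁ t ht
  -- constants
  set c₁ : ℝ := (volume (ball (0 : EuclideanSpace ℝ (Fin 3)) 1)).toReal with hc₁
  have hc₁0 : 0 ≤ c₁ := ENNReal.toReal_nonneg
  set M : ℝ := M₁ + V ^ 2 * c₁ * r₁ ^ 2 + 6 * (C₁ : ℝ) * r₁ + 1 with hM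
  have hC₁0 : 0 ≤ (C₁ : ℝ) := C₁.2
  have hVc : 0 ≤ V ^ 2 * c₁ * r₁ ^ 2 := by positivity
  have h6C : 0 ≤ 6 * (C₁ : ℝ) * r₁ := by positivity
  have hM₁M : M₁ ≤ M := by rw [hM]; linarith
  have hVM : V ^ 2 * c₁ * r₁ ^ 2 ≤ M := by rw [hM]; linarith
  have hCM : 6 * (C₁ : ℝ) * r₁ ≤ M := by rw [hM]; linarith
  refine ⟨M, r₁, by rw [hM]; linarith, hr₁, ?_, ?_⟩
  · -- (A)
    intro s hs x R hR
    by_cases hst : tstar ≤ s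
    · exact (hA s ⟨hst, hs.2⟩ x R hR).trans
        (ENNReal.ofReal_le_ofReal (mul_le_mul_of_nonneg_right hM₁M hR.1.le))
    · have hsI : s ∈ Icc 0 T' := ⟨hs.1, by linarith [not_le.1 hst]⟩
      exact (setLIntegral_ball_sq_le_of_bound hR.1 hR.2 (fun y _ => hV s hsI y)).trans
        (ENNReal.ofReal_le_ofReal (mul_le_mul_of_nonneg_right hVM hR.1.le))
  · -- (E)
    intro b hb x R hR hRb
    have ha : 0 ≤ b - R ^ 2 := sub_nonneg.2 hRb
    by_cases hbt : tstar < b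
    · -- late: Tonelli on the continuous integrand, `‖·‖_op ≤ |·|_F`
      have hprod := hE b ⟨hbt, hb.2⟩ x R hR
      have hsub : Ioo (b - R ^ 2) b ×ˢ ball x R ⊆ Ioo 0 T ×ˢ (univ : Set (EuclideanSpace ℝ (Fin 3))) :=
        prod_mono (Ioo_subset_Ioo ha hb.2) (subset_univ _)
      have hcontF : ContinuousOn
          (fun w : ℝ × EuclideanSpace ℝ (Fin 3) => ENNReal.ofReal (frobeniusNormSq (fderiv ℝ (u w.1) w.2)))
          (Ioo (b - R ^ 2) b ×ˢ ball x R) :=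
        (ENNReal.continuous_ofReal.comp_continuousOn
          (PerturbedEnergyInequality.continuousOn_frobeniusNormSq_fderiv_slice
            (SereginSverak2002.classical_Ioo hsol).smooth_velocity isOpen_Ioo)).mono hsub
      have hmeasF : AEMeasurable
          (fun w : ℝ × EuclideanSpace ℝ (Fin 3) => ENNReal.ofReal (frobeniusNormSq (fderiv ℝ (u w.1) w.2)))
          ((volume.restrict (Ioo (b - R ^ 2) b)).prod (volume.restrict (ball x R))) := by
        rw [Measure.prod_restrict, ← Measure.volume_eq_prod]
        exact hcontF.aemeasurable (measurableSet_Ioo.prod measurableSet_ball)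
      have hton : ∫⁻ t in Ioo (b - R ^ 2) b, ∫⁻ y in ball x R,
          ENNReal.ofReal (frobeniusNormSq (fderiv ℝ (u t) y)) =
          ∫⁻ w in Ioo (b - R ^ 2) b ×ˢ ball x R,
            ENNReal.ofReal (frobeniusNormSq (fderiv ℝ (u w.1) w.2)) := by
        have hμ : (volume.restrict (Ioo (b - R ^ 2) b ×ˢ ball x R) :
            Measure (ℝ × EuclideanSpace ℝ (Fin 3))) =
            (volume.restrict (Ioo (b - R ^ 2) b)).prod (volume.restrict (ball x R)) := by
          rw [Measure.volume_eq_prod, Measure.prod_restrict]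
        rw [hμ, lintegral_prod _ hmeasF]
      calc ∫⁻ t in Ioo (b - R ^ 2) b, ∫⁻ y in ball x R, ‖fderiv ℝ (u t) y‖ₑ ^ 2
          ≤ ∫⁻ t in Ioo (b - R ^ 2) b, ∫⁻ y in ball x R,
              ENNReal.ofReal (frobeniusNormSq (fderiv ℝ (u t) y)) :=
            lintegral_mono fun t => lintegral_mono fun y => enorm_pow_two_le_ofReal_frobeniusNormSq _
        _ = _ := hton
        _ ≤ ENNReal.ofReal (M₁ * R) := hprod
        _ ≤ ENNReal.ofReal (M * R) := ENNReal.ofReal_le_ofReal (mul_le_mul_of_nonneg_right hM₁M hR.1.le)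
    · -- early: `b ≤ t⋆ < T'`, whole-space div–curl and the `H¹` bound on `[0, T']`
      have hbT' : b ≤ T' := (not_lt.1 hbt).trans htT'.le
      have hslice : ∀ t ∈ Ioo (b - R ^ 2) b,
          ∫⁻ y in ball x R, ‖fderiv ℝ (u t) y‖ₑ ^ 2 ≤ 6 * (C₁ : ℝ≥0∞) := by
        intro t ht
        have htI : t ∈ Ico 0 T := ⟨ha.trans ht.1.le, lt_of_lt_of_le ht.2 (hbT'.trans hT'I.2.le)⟩
        have hC2 : ContDiff ℝ 2 (u t) := (hsol.contDiff_velocity htI).of_le (by norm_cast)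
        have hL2 : ∫⁻ y, ‖u t y‖ₑ ^ 2 < ⊤ :=
          lt_of_le_of_lt (hLH.lintegral_enorm_sq_le hν.le ⟨htI.1, htI.2.le⟩) ENNReal.ofReal_lt_top
        calc ∫⁻ y in ball x R, ‖fderiv ℝ (u t) y‖ₑ ^ 2
            ≤ ∫⁻ y, ‖fderiv ℝ (u t) y‖ₑ ^ 2 := setLIntegral_le_lintegral _ _
          _ ≤ ∫⁻ y, ENNReal.ofReal (frobeniusNormSq (fderiv ℝ (u t) y)) :=
              lintegral_mono fun y => enorm_pow_two_le_ofReal_frobeniusNormSq _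
          _ ≤ ∫⁻ y, ‖curl (u t) y‖ₑ ^ 2 :=
              lintegral_frobeniusNormSq_fderiv_le_lintegral_sq_norm_curl hC2 (hsol.divFree t htI) hL2
          _ ≤ 6 * (C₁ : ℝ≥0∞) := hcurl t ⟨htI.1, ht.2.le.trans hbT'⟩
      calc ∫⁻ t in Ioo (b - R ^ 2) b, ∫⁻ y in ball x R, ‖fderiv ℝ (u t) y‖ₑ ^ 2
          ≤ ∫⁻ _ in Ioo (b - R ^ 2) b, 6 * (C₁ : ℝ≥0∞) :=
            setLIntegral_mono' measurableSet_Ioo fun t ht => hslice t ht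
        _ = 6 * (C₁ : ℝ≥0∞) * volume (Ioo (b - R ^ 2) b) := by rw [setLIntegral_const]
        _ = ENNReal.ofReal (6 * (C₁ : ℝ) * R ^ 2) := by
            rw [Real.volume_Ioo, show b - (b - R ^ 2) = R ^ 2 by ring,
              ENNReal.ofReal_mul (by positivity), ENNReal.ofReal_mul (by norm_num),
              ENNReal.ofReal_coe_nnreal, ENNReal.ofReal_ofNat]
        _ ≤ ENNReal.ofReal (M * R) := by
            refine ENNReal.ofReal_le_ofReal ?_
            have h1 : R ^ 2 ≤ r₁ * R := by nlinarith [hR.1, hR.2]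
            calc 6 * (C₁ : ℝ) * R ^ 2 ≤ 6 * (C₁ : ℝ) * (r₁ * R) :=
                  mul_le_mul_of_nonneg_left h1 (by positivity)
              _ = (6 * (C₁ : ℝ) * r₁) * R := by ring
              _ ≤ M * R := mul_le_mul_of_nonneg_right hCM hR.1.le

end Summit.NavierStokesRegularity.NavierStokesRegularity.Theorems.CountQuarterLaw

end
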